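import Summits.BirchSwinnertonDyer.BirchSwinnertonDyer.Theses.ShaPrimaryTransfer
import Summits.BirchSwinnertonDyer.BirchSwinnertonDyer.Theorems.GenusKolyvaginAtTwoCasselsTatePTcRealReadout
import Literature.NumberTheory.EllipticCurves.CasselsTateAlternating
import Literature.NumberTheory.EllipticCurves.BSDRankZeroDensityProofs
import Literature.NumberTheory.EllipticCurves.CasselsTateParity
import Literature.NumberTheory.EllipticCurves.IwasawaLeadingTermProofs
import HarnessLib

/-!
# BirchSwinnertonDyer / ShaPrimaryTransfer — crux `FiniteShaComponentTransfer` (stmt-BirchSwinnertonDyer-22356):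
# `#Ш(E/K)[p] = p^{t_p(E) + 2m}` UNCONDITIONALLY — the corank `t_p` and the `p`-descent defect have the same
# parity (Cassels–Tate is now a tree theorem), and THE ODD DOOR

Helper file of prover seat `bsd-line-spt-p1` g13 (`--supports stmt-22356 --as helper`). THEOREMS ONLY (no definition,
no named fact, no `sorry`). The route's crux T = `FiniteShaComponentTransfer` («`t_p(E) = 0 → t_q(E) = 0`»,
`t_p(E) = W.shaCorank p = corank_{ℤ_p} Ш(E)[p^∞]`) is exercised by DESCENT instruments, which so far could only
certify `t_p = 0` (a closed door); this file makes descent able to certify `t_p ≥ 1` as well and fixes the exact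
relation between `t_p` and what a descent computes. It lives under `Summits/…/Theorems` (not `Literature/`) only
because the Cassels–Tate proof it consumes does (`GenusKolyvaginAtTwoCasselsTatePTcRealReadout`); §1–§3 are
stated for every number field `K : Type`.

The Cassels–Tate pairing on `Ш(E/K)` — alternating, kernel = divisible elements — is the tree
THEOREM `WeierstrassCurve.exists_casselsTate_pairing_holds` (file `Summits/…/GenusKolyvaginAtTwoCasselsTatePairingRat`,
discharging the named fact `WeierstrassCurve.exists_casselsTate_pairing`, bsd.S18, for every number field
`K : Type`), so the parity statements the tree proved MODULO that fact (`CasselsTateParity`,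
`BSDRankZeroDensityProofs.exists_selmerRank_eq_add`) become unconditional (§0 re-derives the discharge from its
two route-independent inputs, so that this file stays out of the cone of route file `GenusKolyvaginAtTwo`). This
file records them in the currency of the corank `t_p(E) := W.shaCorank p = corank_{ℤ_p} Ш(E/K)[p^∞]` and draws the consequence that
matters for the route's instruments: **a complete `p`-descent can certify that `Ш(E/K)[p^∞]` is INFINITE** (a
non-square `p`-descent defect).

For an elliptic curve `E` over a number field `K : Type` and a prime `p`:

* §1 `exists_natCard_sha_torsionBy_eq_pow`: **`#Ш(E/K)[p] = p^{t_p(E) + 2m}` for some `m`** — i.e.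
  `Ш[p^∞] ≅ (ℚ_p/ℤ_p)^{t_p} ⊕ F` with `#F[p]` a square (Dokchitser, *Notes on the parity conjecture*, §2:
  "`Ш[p^∞] ≅ (ℚ_p/ℤ_p)^{δ_p} ×` (finite group of square order)"). Proof: `#Ш[p] = #Ш[p^∞][p] = p^u`,
  `t_p = u - dim Ш[p^∞]/p` (`zpCorank`, with `dim Ш[p^∞]/p ≤ u` by `finite_modN_of_primary`) and
  `dim_{𝔽_p} Ш[p^∞]/p` is even (`even_finrank_modN_primaryComponent_sha` + the discharge).
  Corollaries: `pow_shaCorank_dvd_natCard_sha_torsionBy` (`p^{t_p} ∣ #Ш[p]`),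
  `exists_eq_shaCorank_add_two_mul` (`#Ш[p] = p^d ⇒ d = t_p + 2m`), `shaCorank_mod_two_eq`
  (`t_p ≡ d (mod 2)`), `isSquare_natCard_sha_torsionBy_iff_even_shaCorank` (`#Ш[p]` square ⟺ `t_p` even),
  `isSquare_natCard_sha_torsionBy_of_shaCorank_eq_zero`.
* §2 THE ODD DOOR: `one_le_shaCorank_of_not_isSquare` (**`#Ш(E/K)[p]` not a square ⟹ `t_p(E) ≥ 1`**),
  `odd_shaCorank_of_natCard_eq_pow_odd`, `infinite_shaPrimary_of_not_isSquare` (then `Ш(E/K)[p^∞]` is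
  infinite, `finite_primaryComponent_sha_iff_shaCorank_eq_zero`), `infinite_sha_of_not_isSquare`.
  Conjecturally (BSD) the hypothesis is never met; the point is that it is DECIDABLE by one complete descent.
* §3 SELMER CURRENCY (what a descent computes): `exists_selmerRank_eq_selmerCorank_add`
  (`#Sel^(p) = p^s`, `#E(K)[p] = p^t ⟹ s = t + corank Sel_{p^∞} + 2m`, the tree's `exists_selmerRank_eq_add`
  made unconditional) and, over `ℚ`, the two vendored forms of the Dokchitser–Dokchitser `p`-parity theorem —
  `p_parity` (corank form, bsd.S19) and `even_selmerRank_sub_torsionRank_iff` (Selmer-rank form,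
  Bhargava–Shankar Thm 42) — are EQUIVALENT with no further input
  (`forall_p_parity_iff_even_selmerRank_sub_torsionRank_iff`; the tree had each direction modulo `hCT`).
* §4 THE ROUTE (`K = ℚ`). T's PREDICTION in descent currency: granting T, one closed door `t_p(E) = 0` makes EVERY
  `#Ш(E)[q]` a square (`isSquare_natCard_sha_torsionBy_of_transfer`, pure-descent form `…_of_natCard_eq_one`) and
  every `q`-Selmer rank satisfy `s ≡ t + rank E(ℚ) (mod 2)` (`selmerRank_mod_two_eq_of_transfer`); read
  backwards, a non-square defect at one prime opens every door (`one_le_shaCorank_of_transfer_of_not_isSquare`,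
  `infinite_shaPrimary_of_transfer_of_not_isSquare`); T ∧ O ⟹ every descent defect of every `E/ℚ` is a square
  (`isSquare_natCard_sha_torsionBy_of_transfer_of_door`). The CONTRAPOSITIVES are T's cheapest KILL SHAPE — two
  complete descents, `Ш(E)[p] = 0` and `#Ш(E)[q]` non-square (the route header asked for a certified `t_q ≥ 2` by
  Iwasawa theory) — and granting the `p`-parity theorem that kill never fires
  (`isSquare_natCard_sha_torsionBy_of_p_parity`): a counterexample to T has `t_q ≥ 2` and square defects.

Nothing here proves T, O or BSD; T stays conjecture-grade at analytic rank ≥ 2.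

## References

* J. W. S. Cassels, Arithmetic on curves of genus 1. IV. Proof of the Hauptvermutung, J. reine angew. Math.
  211 (1962) 95–112, Thm. 1.1. [Cassels1962ArithmeticIV]
* J. S. Milne, *Arithmetic Duality Theorems*, 2nd ed. (2006), I.6.13(a), I.6.26. [MilneADT2006]
* J. H. Silverman, *The Arithmetic of Elliptic Curves*, 2nd ed. (2009), Thm. X.4.14. [SilvermanAEC2009]
* T. Dokchitser, Notes on the parity conjecture, in: Elliptic curves, Hilbert modular forms and Galois
  deformations, Birkhäuser (2013), §2. [Dokchitser2013ParityNotes]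
* T. Dokchitser, V. Dokchitser, On the Birch–Swinnerton-Dyer quotients modulo squares, Ann. of Math. 172
  (2010), Thm. 1.4. [DokchitserDokchitserAnnals2010]
-/

-- D-0017: single-problem summit, so `Summit.BirchSwinnertonDyer.BirchSwinnertonDyer.…` repeats a namespace BY DESIGN.
set_option linter.dupNamespace false
set_option autoImplicit false

noncomputable section

open scoped Classical
open scoped AddSubgroup
open Literature.Algebra.Module Literature.NumberTheory.EllipticCurves WeierstrassCurve

namespace Summit.BirchSwinnertonDyer.BirchSwinnertonDyer.Theorems.ShaPrimaryTransferOddDoor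

/-! ## §0 The Cassels–Tate theorem (tree theorem), route-independent re-derivation -/

/-- **The Cassels–Tate theorem over every number field `K : Type`** — verbatim the tree theorem
`WeierstrassCurve.exists_casselsTate_pairing_holds` (seat gk2-p1 g13, file `GenusKolyvaginAtTwoCasselsTatePairingRat`,
which imports route file `GenusKolyvaginAtTwo`), re-derived by the same one-line composition of its two
route-independent inputs: `GenusExact.CasselsTatePTcReal.exists_casselsTate_pairing_of_levelThetaDatum` (the
pairing modulo a level-theta datum at every even level `2^k`) and `levelThetaDatumEven` (Morgan–Smith 2021 §5).
Kept here only so that this file does not sit in the cone of another route's Theses file (`lint.theses-cone`).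
[cite: Cassels1962ArithmeticIV, §1] [cite: MilneADT2006, Ch. I §6 Thm. 6.13 (a)(b)] [cite: MorganSmith2021CTP, §5 Thm. 5.10] -/
theorem casselsTate_pairing {L : Type} [Field L] [NumberField L] :
    WeierstrassCurve.exists_casselsTate_pairing (K := L) :=
  GenusExact.CasselsTatePTcReal.exists_casselsTate_pairing_of_levelThetaDatum (K := L)
    fun V _ k hk _ e hμ hadd₁ hadd₂ _hgal halt _hnd =>
      ⟨levelThetaDatumEven V (2 ^ k) e hμ hadd₁ hadd₂ halt (Nat.even_pow.mpr ⟨even_two, hk.ne'⟩)⟩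

variable {K : Type} [Field K] [NumberField K] (W : WeierstrassCurve K) [W.IsElliptic]
  (p : ℕ) [hp : Fact p.Prime]

/-! ## §1 `#Ш(E/K)[p] = p ^ (t_p + 2m)` -/

/-- **`dim_{𝔽_p} Ш(E/K)[p^∞]/p` is even, unconditionally**: the tree's
`even_finrank_modN_primaryComponent_sha` with its Cassels–Tate hypothesis discharged by
`WeierstrassCurve.exists_casselsTate_pairing_holds`. [cite: MilneADT2006, Ch. I Thm. 6.13(a)] -/
theorem even_finrank_modN_shaPrimary :
    Even (Module.finrank (ZMod p) (ModN ↥(AddCommGroup.primaryComponent W.sha p) p)) :=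
  even_finrank_modN_primaryComponent_sha W p casselsTate_pairing

/-- **`#Ш(E/K)[p] = p^{t_p(E) + 2m}`** for an elliptic curve over a number field and a prime `p`, where
`t_p(E) = W.shaCorank p = corank_{ℤ_p} Ш(E/K)[p^∞]`, unconditionally (Cassels–Tate is a tree theorem):
`Ш(E/K)[p^∞] ≅ (ℚ_p/ℤ_p)^{t_p} ⊕ F` with `dim_{𝔽_p} F[p] = dim_{𝔽_p} Ш[p^∞]/p` even.
[cite: Dokchitser2013ParityNotes, §2 (first display)] [cite: MilneADT2006, Ch. I Thm. 6.13(a)] -/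
theorem exists_natCard_sha_torsionBy_eq_pow :
    ∃ m : ℕ, Nat.card (W.sha[(p : ℤ)]) = p ^ (W.shaCorank p + 2 * m) := by
  have hp0' : (p : ℤ) ≠ 0 := Int.natCast_ne_zero.mpr hp.out.ne_zero
  set T : AddSubgroup W.sha := AddCommGroup.primaryComponent W.sha p with hT
  haveI hShafin : Finite ((W.sha)[(p : ℤ)]) := W.finite_sha_torsionBy_holds (p : ℤ) hp0'
  have hcard2 : Nat.card (T[(p : ℤ)]) = Nat.card ((W.sha)[(p : ℤ)]) :=
    natCard_torsionBy_primaryComponent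
  letI : Module (ZMod p) (T[(p : ℤ)]) := AddSubgroup.torsionBy.zmodModule
  haveI hTfin : Finite (T[(p : ℤ)]) :=
    Nat.finite_of_card_ne_zero (by rw [hcard2]; exact Nat.card_pos.ne')
  set u : ℕ := Module.finrank (ZMod p) (T[(p : ℤ)]) with hu
  have hpu : p ^ u = Nat.card (T[(p : ℤ)]) := pow_finrank_eq_natCard _
  -- `dim Ш[p^∞]/p` is even (Cassels–Tate) and at most `u`
  obtain ⟨v, hv⟩ := even_finrank_modN_shaPrimary W p
  have hTprim : ∀ c : T, ∃ n : ℕ, p ^ n • c = 0 := fun c ↦ by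
    obtain ⟨n, hn⟩ := (AddCommGroup.mem_primaryComponent).mp c.2
    exact ⟨n, Subtype.ext (by rw [AddSubgroupClass.coe_nsmul, hn, ZeroMemClass.coe_zero])⟩
  obtain ⟨hfin, hle⟩ := finite_modN_of_primary (C := T) (p := p) hTprim
  haveI := hfin
  have hle' : Module.finrank (ZMod p) (ModN T p) ≤ u := by
    rw [← Nat.pow_le_pow_iff_right hp.out.one_lt, pow_finrank_eq_natCard, hpu]
    exact hle
  -- the corank formula
  have hcorank : W.shaCorank p = u - Module.finrank (ZMod p) (ModN T p) := rfl
  have hv' : Module.finrank (ZMod p) (ModN T p) = v + v := hv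
  have hkey : u = W.shaCorank p + 2 * v := by rw [hcorank]; omega
  exact ⟨v, by rw [← hcard2, ← hpu, hkey]⟩

/-- **`p^{t_p(E)}` divides `#Ш(E/K)[p]`**. [cite: Dokchitser2013ParityNotes, §2] -/
theorem pow_shaCorank_dvd_natCard_sha_torsionBy : p ^ W.shaCorank p ∣ Nat.card (W.sha[(p : ℤ)]) := by
  obtain ⟨m, hm⟩ := exists_natCard_sha_torsionBy_eq_pow W p
  rw [hm, pow_add]
  exact Dvd.intro _ rfl

/-- **Reading a complete `p`-descent**: if `#Ш(E/K)[p] = p^d` then `d = t_p(E) + 2m` for some `m`.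
[cite: Dokchitser2013ParityNotes, §2] -/
theorem exists_eq_shaCorank_add_two_mul {d : ℕ} (hd : Nat.card (W.sha[(p : ℤ)]) = p ^ d) :
    ∃ m : ℕ, d = W.shaCorank p + 2 * m := by
  obtain ⟨m, hm⟩ := exists_natCard_sha_torsionBy_eq_pow W p
  exact ⟨m, Nat.pow_right_injective hp.out.two_le (hd.symm.trans hm)⟩

/-- `t_p(E) ≤ dim_{𝔽_p} Ш(E/K)[p]`: if `#Ш(E/K)[p] = p^d` then `t_p(E) ≤ d` (so `Ш[p] = 0` closes the door,
`t_p = 0`). [cite: Dokchitser2013ParityNotes, §2] -/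
theorem shaCorank_le_of_natCard_eq_pow {d : ℕ} (hd : Nat.card (W.sha[(p : ℤ)]) = p ^ d) :
    W.shaCorank p ≤ d := by
  obtain ⟨m, hm⟩ := exists_eq_shaCorank_add_two_mul W p hd
  omega

/-- **`t_p(E) ≡ dim_{𝔽_p} Ш(E/K)[p] (mod 2)`**: if `#Ш(E/K)[p] = p^d` then `t_p(E) % 2 = d % 2`.
[cite: Dokchitser2013ParityNotes, §2] -/
theorem shaCorank_mod_two_eq {d : ℕ} (hd : Nat.card (W.sha[(p : ℤ)]) = p ^ d) :
    W.shaCorank p % 2 = d % 2 := by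
  obtain ⟨m, hm⟩ := exists_eq_shaCorank_add_two_mul W p hd
  omega

/-- `Ш(E/K)[p] = 0` gives `t_p(E) = 0` (the door of a complete first descent, in `Nat.card` form).
[cite: SilvermanAEC2009, Thm. X.4.2] -/
theorem shaCorank_eq_zero_of_natCard_sha_torsionBy_eq_one (h1 : Nat.card (W.sha[(p : ℤ)]) = 1) :
    W.shaCorank p = 0 := by
  have h := shaCorank_le_of_natCard_eq_pow W p (d := 0) (by rw [h1, pow_zero])
  omega

/-- For a prime `p`, `p ^ n` is a perfect square iff `n` is even. [folklore] -/
theorem isSquare_prime_pow_iff {n : ℕ} : IsSquare (p ^ n) ↔ Even n := by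
  constructor
  · rintro ⟨a, ha⟩
    have hdvd : a ∣ p ^ n := Dvd.intro _ ha.symm
    obtain ⟨k, -, rfl⟩ := (Nat.dvd_prime_pow hp.out).mp hdvd
    rw [← pow_add] at ha
    exact ⟨k, Nat.pow_right_injective hp.out.two_le ha⟩
  · rintro ⟨k, rfl⟩
    exact ⟨p ^ k, by rw [← pow_add]⟩

/-- **`#Ш(E/K)[p]` is a perfect square iff `t_p(E)` is even.** [cite: Dokchitser2013ParityNotes, §2]
[cite: SilvermanAEC2009, Thm. X.4.14] -/
theorem isSquare_natCard_sha_torsionBy_iff_even_shaCorank :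
    IsSquare (Nat.card (W.sha[(p : ℤ)])) ↔ Even (W.shaCorank p) := by
  obtain ⟨m, hm⟩ := exists_natCard_sha_torsionBy_eq_pow W p
  rw [hm, isSquare_prime_pow_iff p, Nat.even_add]
  have h2 : Even (2 * m) := even_two_mul m
  tauto

/-- **Behind a closed door the `p`-descent defect is a square**: `t_p(E) = 0 ⟹ #Ш(E/K)[p]` is a perfect
square. [cite: SilvermanAEC2009, Thm. X.4.14] -/
theorem isSquare_natCard_sha_torsionBy_of_shaCorank_eq_zero (h0 : W.shaCorank p = 0) :
    IsSquare (Nat.card (W.sha[(p : ℤ)])) :=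
  (isSquare_natCard_sha_torsionBy_iff_even_shaCorank W p).mpr (by rw [h0]; exact ⟨0, rfl⟩)

/-! ## §2 The odd door: a non-square `p`-descent defect certifies that `Ш(E/K)[p^∞]` is infinite -/

/-- **THE ODD DOOR**: if `#Ш(E/K)[p]` is NOT a perfect square then `t_p(E) = corank_{ℤ_p} Ш(E/K)[p^∞] ≥ 1`.
[cite: Dokchitser2013ParityNotes, §2] -/
theorem one_le_shaCorank_of_not_isSquare (h : ¬ IsSquare (Nat.card (W.sha[(p : ℤ)]))) :
    1 ≤ W.shaCorank p := by
  rw [isSquare_natCard_sha_torsionBy_iff_even_shaCorank W p, Nat.not_even_iff_odd] at h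
  exact h.pos

/-- Odd-exponent form: `#Ш(E/K)[p] = p^d` with `d` odd ⟹ `t_p(E)` is odd (in particular `≥ 1`).
[cite: Dokchitser2013ParityNotes, §2] -/
theorem odd_shaCorank_of_natCard_eq_pow_odd {d : ℕ} (hd : Nat.card (W.sha[(p : ℤ)]) = p ^ d)
    (hodd : Odd d) : Odd (W.shaCorank p) := by
  obtain ⟨m, hm⟩ := exists_eq_shaCorank_add_two_mul W p hd
  rw [hm, Nat.odd_add] at hodd
  exact hodd.mpr (even_two_mul m)

/-- **A non-square `p`-descent defect certifies that `Ш(E/K)[p^∞]` is INFINITE** (`t_p ≥ 1` and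
`finite_primaryComponent_sha_iff_shaCorank_eq_zero`). [cite: Dokchitser2013ParityNotes, §2]
[cite: SilvermanAEC2009, Thm. X.4.14] -/
theorem infinite_shaPrimary_of_not_isSquare (h : ¬ IsSquare (Nat.card (W.sha[(p : ℤ)]))) :
    Infinite ↥(AddCommGroup.primaryComponent W.sha p) := by
  have h1 := one_le_shaCorank_of_not_isSquare W p h
  rw [← not_finite_iff_infinite, finite_primaryComponent_sha_iff_shaCorank_eq_zero W p]
  omega

/-- **A non-square `p`-descent defect certifies that `Ш(E/K)` is infinite.** Contrapositive reading of
Cassels' theorem "Ш finite ⟹ #Ш square" sharpened to ONE prime: only `Ш[p]` has to be computed.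
[cite: Cassels1962ArithmeticIV, Thm. 1.1] [cite: SilvermanAEC2009, Thm. X.4.14] -/
theorem infinite_sha_of_not_isSquare (h : ¬ IsSquare (Nat.card (W.sha[(p : ℤ)]))) : Infinite W.sha :=
  haveI := infinite_shaPrimary_of_not_isSquare W p h
  Infinite.of_injective (fun x : ↥(AddCommGroup.primaryComponent W.sha p) ↦ (x : W.sha))
    Subtype.val_injective

/-- Odd-exponent form: `#Ш(E/K)[p] = p^d`, `d` odd ⟹ `Ш(E/K)[p^∞]` is infinite.
[cite: Dokchitser2013ParityNotes, §2] -/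
theorem infinite_shaPrimary_of_natCard_eq_pow_odd {d : ℕ} (hd : Nat.card (W.sha[(p : ℤ)]) = p ^ d)
    (hodd : Odd d) : Infinite ↥(AddCommGroup.primaryComponent W.sha p) := by
  refine infinite_shaPrimary_of_not_isSquare W p fun hsq ↦ ?_
  rw [hd, isSquare_prime_pow_iff p] at hsq
  exact (Nat.not_even_iff_odd.mpr hodd) hsq

/-- **What a counterexample to T must show to a first descent** (unconditional): `t_q(E) ≠ 0` forces
`#Ш(E/K)[q] ≠ 1`, i.e. the complete `q`-descent does NOT close (`Ш(E)[q] ≠ 0`). So T holds at `(E, p, q)` whenever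
`Ш(E)[q] = 0`, and a refutation of T needs a curve whose `q`-descent leaves a (square, see §4) defect.
[cite: Dokchitser2013ParityNotes, §2] -/
theorem natCard_sha_torsionBy_ne_one_of_shaCorank_ne_zero (hq0 : W.shaCorank p ≠ 0) :
    Nat.card (W.sha[(p : ℤ)]) ≠ 1 := fun h1 ↦
  hq0 (shaCorank_eq_zero_of_natCard_sha_torsionBy_eq_one W p h1)

/-! ## §3 Selmer currency and the two forms of the `p`-parity theorem -/

/-- **`s = t + corank_{ℤ_p} Sel_{p^∞}(E/K) + 2m`** for `#Sel^(p)(E/K) = p^s`, `#E(K)[p] = p^t`, unconditionally: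
the tree's `exists_selmerRank_eq_add` with its Cassels–Tate hypothesis discharged. This is the parity
computed by an actual `p`-descent: `s - t - rank E(K) ≡ t_p(E) (mod 2)`.
[cite: Dokchitser2013ParityNotes, §2 (first display and Definition)] -/
theorem exists_selmerRank_eq_selmerCorank_add (s t : ℕ) (hs : Nat.card (W.selmerGroup p) = p ^ s)
    (ht : Nat.card (W.toAffine.Point[(p : ℤ)]) = p ^ t) :
    ∃ m : ℕ, s = t + W.selmerCorank p + 2 * m :=
  exists_selmerRank_eq_add casselsTate_pairing W p s t hs ht

/-- Descent-rank form of the same: `s = t + rank E(K) + t_p(E) + 2m` (`corank Sel_{p^∞} = rank + t_p`,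
tree theorem `selmerCorank_eq_mordellWeilRank_add_holds`). [cite: Dokchitser2013ParityNotes, §2] -/
theorem exists_selmerRank_eq_rank_add_shaCorank_add (s t : ℕ) (hs : Nat.card (W.selmerGroup p) = p ^ s)
    (ht : Nat.card (W.toAffine.Point[(p : ℤ)]) = p ^ t) :
    ∃ m : ℕ, s = t + W.mordellWeilRank + W.shaCorank p + 2 * m := by
  obtain ⟨m, hm⟩ := exists_selmerRank_eq_selmerCorank_add W p s t hs ht
  rw [W.selmerCorank_eq_mordellWeilRank_add_holds p] at hm
  exact ⟨m, by omega⟩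

/-- **The two vendored forms of the `p`-parity theorem over `ℚ` are equivalent with no further input**:
`∀ E p, (-1)^{corank Sel_{p^∞}(E/ℚ)} = w(E)` (`p_parity`, Dokchitser–Dokchitser 2010 Thm. 1.4, corank form)
iff `∀ E p s t, #Sel^(p) = p^s → #E(ℚ)[p] = p^t → (s - t even ↔ w(E) = 1)`
(`even_selmerRank_sub_torsionRank_iff`, Bhargava–Shankar Thm 42 form). The tree had both directions
modulo the Cassels–Tate fact (`even_selmerRank_sub_torsionRank_iff_of_facts`,
`p_parity_of_even_selmerRank_sub_torsionRank_iff`); the fact is now a theorem.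
[cite: DokchitserDokchitserAnnals2010, Conj. 1.2 and Thm. 1.4] [cite: BhargavaShankarTernary2015, Thm 42] -/
theorem forall_p_parity_iff_even_selmerRank_sub_torsionRank_iff :
    (∀ (V : WeierstrassCurve ℚ) [V.IsElliptic] (q : ℕ) [Fact q.Prime], p_parity V q) ↔
      even_selmerRank_sub_torsionRank_iff :=
  ⟨fun h ↦ even_selmerRank_sub_torsionRank_iff_of_facts h casselsTate_pairing,
    fun h V _ q _ ↦ p_parity_of_even_selmerRank_sub_torsionRank_iff h casselsTate_pairing V q⟩


/-! ## §4 The route: T's prediction in DESCENT currency, and the kill shape it exposes -/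

section Route

open Summit.BirchSwinnertonDyer.BirchSwinnertonDyer.Theses.ShaPrimaryTransfer
  (FiniteShaComponentTransfer OneFiniteShaComponent)

variable (E : WeierstrassCurve ℚ) [E.IsElliptic] (q : ℕ) [hq : Fact q.Prime]

/-- **T's PREDICTION in descent currency**: granting T = `FiniteShaComponentTransfer`, behind ONE closed door
(`t_p(E) = 0`) EVERY descent defect `#Ш(E)[q]` is a perfect square — a statement every cross-prime row of the
route's table can be checked against (rows 1–8: `t_2 = 0` and `Ш[3] = 0`, a square). CONTRAPOSITIVE = T's KILL
SHAPE, certifiable by two complete descents and nothing else: a curve with `t_p(E) = 0` (e.g. `Ш(E)[p] = 0`) and a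
NON-SQUARE `#Ш(E)[q]` refutes T (the odd door gives `t_q(E) ≥ 1`); the route header's cheapest kill needed a
certified `t_q ≥ 2` by Iwasawa theory. No such curve is known; under BSD none exists.
[cite: SilvermanAEC2009, Thm. X.4.14] [cite: Dokchitser2013ParityNotes, §2] -/
theorem isSquare_natCard_sha_torsionBy_of_transfer (hT : FiniteShaComponentTransfer) (h0 : E.shaCorank p = 0) :
    IsSquare (Nat.card (E.sha[(q : ℤ)])) :=
  isSquare_natCard_sha_torsionBy_of_shaCorank_eq_zero E q (hT E p q h0)

/-- Pure-descent form: granting T, `Ш(E)[p] = 0` (a complete `p`-descent closes) forces every `#Ш(E)[q]` to be a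
square. [cite: SilvermanAEC2009, Thm. X.4.14] -/
theorem isSquare_natCard_sha_torsionBy_of_transfer_of_natCard_eq_one (hT : FiniteShaComponentTransfer)
    (h1 : Nat.card (E.sha[(p : ℤ)]) = 1) : IsSquare (Nat.card (E.sha[(q : ℤ)])) :=
  isSquare_natCard_sha_torsionBy_of_transfer p E q hT (shaCorank_eq_zero_of_natCard_sha_torsionBy_eq_one E p h1)

/-- **T's prediction in SELMER currency** (what `q`-descent software reports): granting T and a closed door
`t_p(E) = 0`, for every prime `q` with `#Sel^(q)(E/ℚ) = q^s`, `#E(ℚ)[q] = q^t`: `s ≡ t + rank E(ℚ) (mod 2)`.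
Contrapositive = kill shape in Selmer currency: ONE `q`-descent of the wrong parity behind a closed door refutes T.
[cite: Dokchitser2013ParityNotes, §2] -/
theorem selmerRank_mod_two_eq_of_transfer (hT : FiniteShaComponentTransfer) (h0 : E.shaCorank p = 0)
    (s t : ℕ) (hs : Nat.card (E.selmerGroup q) = q ^ s) (ht : Nat.card (E.toAffine.Point[(q : ℤ)]) = q ^ t) :
    s % 2 = (t + E.mordellWeilRank) % 2 := by
  obtain ⟨m, hm⟩ := exists_selmerRank_eq_rank_add_shaCorank_add E q s t hs (by convert ht)
  have h2 := hT E p q h0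
  omega

/-- **T read backwards — a non-square defect OPENS EVERY DOOR**: granting T, if `#Ш(E)[q]` is not a square then
`t_p(E) ≥ 1` for EVERY prime `p` (T says the doors of `E` are all closed or all open; the odd door at `q` is open).
[cite: Dokchitser2013ParityNotes, §2] -/
theorem one_le_shaCorank_of_transfer_of_not_isSquare (hT : FiniteShaComponentTransfer)
    (hodd : ¬ IsSquare (Nat.card (E.sha[(q : ℤ)]))) : 1 ≤ E.shaCorank p := by
  have h1 := one_le_shaCorank_of_not_isSquare E q hodd
  by_contra h
  have h0 : E.shaCorank p = 0 := by omega
  have h2 := hT E p q h0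
  omega

/-- Hence, granting T, a non-square `q`-descent defect makes `Ш(E)[p^∞]` infinite at EVERY prime `p`.
[cite: Dokchitser2013ParityNotes, §2] -/
theorem infinite_shaPrimary_of_transfer_of_not_isSquare (hT : FiniteShaComponentTransfer)
    (hodd : ¬ IsSquare (Nat.card (E.sha[(q : ℤ)]))) : Infinite ↥(AddCommGroup.primaryComponent E.sha p) := by
  have h1 := one_le_shaCorank_of_transfer_of_not_isSquare p E q hT hodd
  rw [← not_finite_iff_infinite, finite_primaryComponent_sha_iff_shaCorank_eq_zero E p]
  omega

omit hp [E.IsElliptic] hq in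
/-- **The kernel T ∧ O predicts: every descent defect of every elliptic curve over `ℚ` is a perfect square.**
[cite: SilvermanAEC2009, Thm. X.4.14] -/
theorem isSquare_natCard_sha_torsionBy_of_transfer_of_door (hT : FiniteShaComponentTransfer)
    (hO : OneFiniteShaComponent) (V : WeierstrassCurve ℚ) [V.IsElliptic] (ℓ : ℕ) [Fact ℓ.Prime] :
    IsSquare (Nat.card (V.sha[(ℓ : ℤ)])) := by
  obtain ⟨p₀, hp₀, h0⟩ := hO V
  exact isSquare_natCard_sha_torsionBy_of_shaCorank_eq_zero V ℓ (hT V p₀ ℓ h0)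

/-- **Under the `p`-parity theorem T's descent prediction is already a theorem** (so the odd-door kill never fires,
granting Dokchitser–Dokchitser): `p`-parity at `p` and at `q` (named fact `p_parity`, CONDITIONAL — `hpp`, `hpq`)
and a closed door `t_p(E) = 0` give `t_q(E)` even (`(-1)^{r + t_p} = w(E) = (-1)^{r + t_q}`; cf.
`ShaPrimaryTransferSlices.even_shaCorank_of_shaCorank_eq_zero_of_p_parity`), hence `#Ш(E)[q]` is a square. A
counterexample to T therefore has `t_q(E) ≥ 2` with a SQUARE `q`-descent defect: it is invisible to the PARITY of
any first descent (though not to its size, `natCard_sha_torsionBy_ne_one_of_shaCorank_ne_zero`).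
[cite: DokchitserDokchitserAnnals2010, Thm. 1.4] -/
theorem isSquare_natCard_sha_torsionBy_of_p_parity (hpp : p_parity E p) (hpq : p_parity E q)
    (h0 : E.shaCorank p = 0) : IsSquare (Nat.card (E.sha[(q : ℤ)])) := by
  refine (isSquare_natCard_sha_torsionBy_iff_even_shaCorank E q).mpr ?_
  have hp' : (-1 : ℤ) ^ E.selmerCorank p = E.rootNumber := hpp
  have hq' : (-1 : ℤ) ^ E.selmerCorank q = E.rootNumber := hpq
  have h : (-1 : ℤ) ^ E.selmerCorank p = (-1 : ℤ) ^ E.selmerCorank q := hp'.trans hq'.symm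
  rw [E.selmerCorank_eq_mordellWeilRank_add_holds p, E.selmerCorank_eq_mordellWeilRank_add_holds q, h0,
    add_zero, pow_add] at h
  rcases Nat.even_or_odd (E.shaCorank q) with he | ho
  · exact he
  · exfalso
    rw [ho.neg_one_pow, mul_neg, mul_one] at h
    rcases neg_one_pow_eq_or ℤ E.mordellWeilRank with h3 | h3 <;> rw [h3] at h <;> norm_num at h

end Route

end Summit.BirchSwinnertonDyer.BirchSwinnertonDyer.Theorems.ShaPrimaryTransferOddDoor

end
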